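import Summits.BirchSwinnertonDyer.BirchSwinnertonDyer.Cruxes.EllipticUnitValueSevenOfGZK.CuspidalDescentSketch
import Literature.NumberTheory.EllipticCurves.NonvanishingTwistsPrescribedSplittingOfHoffsteinLuoProofs
import Literature.NumberTheory.EllipticCurves.RootNumberEvenAnalyticRankProofs

/-!
# Cuspidal descent on 𝒞₇ — the FIELD HALF of C⁺ (i) is THEOREM A (typed link no. 2)

Crux `stmt-BirchSwinnertonDyer-19945` (`RamifiedSevenEllipticUnits.EllipticUnitValueSevenOfGZK`), crux idea
`cuspidal-descent-kolyvagin-nonvanishing` (card REV 19), memo `CuspidalDescentSupply-g43.md` §5. No summit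
statement is proved here; crux 19945 remains OPEN. CERTIFICATE (elaborates, 0 sorries), not a line, not a
skeleton (W-79).

C⁺ (i) = `CuspidalDescent.KolyvaginNonvanishingModSevenTypeIII` (`CuspidalDescentSketch.lean`, g26) asks, for
every type-III member `W ∈ 𝒞₇` and every modular parametrisation datum with `7 ∤ c`, for an imaginary
quadratic `K″` (`d_{K″} ∉ {−3, −4}`, Heegner hypothesis for `N(W)`) AND a Kolyvagin datum over `K″` whose
derived point is not `7`-divisible. The card's assembly chain splits this as «pick `K″` by P1* (THEOREM A),
then K1 ∧ K3′ give the datum». This file checks that split in the kernel: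

* `KolyvaginDatumHalfSeven` — the ∀-form of the datum half over ANALYTICALLY ADMISSIBLE fields: for every
  such `W`, datum, and every imaginary quadratic `K″` with the Heegner hypothesis for `N(W)`, `7` split,
  `d_{K″} ≡ 1 (mod 8)` and `L(W^{(d_{K″})}, 1) ≠ 0` (so `W/K″` has analytic rank one — the regime in which
  K1 ∧ K3′ operate), some derived Heegner point of square-free Kolyvagin level is not `7`-divisible;
* `kolyvaginNonvanishing_of_datumHalf` — `KolyvaginDatumHalfSeven → C⁺ (i)` given `hFH` (Friedberg–Hoffstein
  1995 Thm. B named fact) and `hmod` (Modularity): THEOREM A (the term of `HeegnerFieldSupply.ClassCSeven.exists_admissibleHeegnerField` in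
  `CuspidalDescentHeegnerFieldSupply.lean`, inlined here with bound `B = 4`, which excludes `d_{K″} ∈ {−3, −4}`)
  supplies the field.

So after this file the `∃ K″` of C⁺ (i) is DISCHARGED by tree theorems + two named inputs, and what the line
still owes on C⁺ (i) is exactly `KolyvaginDatumHalfSeven` (= K1 ∧ K3′ of the card, paper-settled / cite-only).
[cite: FriedbergHoffstein1995, Thm. B] [cite: GrossZagier1986, I (6.3)] [cite: Kolyvagin1991, Thm. 1]
-/

noncomputable section

set_option linter.dupNamespace false

open scoped Classical

open WeierstrassCurve Literature Literature.NumberTheory.EllipticCurves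
  Literature.NumberTheory.EllipticCurves.ModularForms
  Summit.BirchSwinnertonDyer.Rank1Residual Summit.BirchSwinnertonDyer.Rank1Residual.X12

namespace Summit.BirchSwinnertonDyer.BirchSwinnertonDyer.Cruxes.EllipticUnitValueSevenOfGZK.CuspidalDescent

/-- **The datum half of C⁺ (i), over analytically admissible auxiliary fields.** For every globally
minimal type-III member `W ∈ 𝒞₇` (`ord₇ Δ = 3`), every modular parametrisation datum with `7 ∤ c`, and
every imaginary quadratic `K″` with the Heegner hypothesis for `N(W)`, `7` split, `d_{K″} ≡ 1 (mod 8)` and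
`L(W^{(d_{K″})}, 1) ≠ 0`: an orientation, a square-free product `n` of Kolyvagin primes for `(W, K″, 7)` and
a Kolyvagin datum of level `n` whose derived point `P(n)` is not `7`-divisible in `E(K″[n])`. (The card's
K1 ∧ K3′; `d_{K″} ≡ 1 (mod 8)` and `|d_{K″}| > 4` make `d_{K″} ∉ {−3, −4}` automatic.)
[cite: Kolyvagin1991, Thm. 1] [cite: GrossZagier1986, I (6.3)] -/
def KolyvaginDatumHalfSeven : Prop :=
  ∀ (W : WeierstrassCurve ℚ) [W.IsElliptic] [W.IsGloballyMinimal] [NeZero (W.conductorNorm ℤ)]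
    [Fact (Nat.Prime 7)],
    ClassCSeven W → padicValRat 7 W.Δ = 3 →
    ∀ (Dt : ModularParametrizationData W (W.conductorNorm ℤ)), ¬ (7 : ℤ) ∣ Dt.c →
    ∀ (K : Type) [Field K] [NumberField K], IsImaginaryQuadratic K →
      SatisfiesHeegnerHypothesis (W.conductorNorm ℤ) K → SatisfiesHeegnerHypothesis 7 K →
      NumberField.discr K % 8 = 1 → 4 < (NumberField.discr K).natAbs →
      (W.quadraticTwist (NumberField.discr K : ℚ)).entireLFunction 1 ≠ 0 →
      ∃ (β : ℤ) (ι : K →+* ℂ) (n : ℕ) (d : KolyvaginHeegnerData Dt β ι n),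
        Squarefree n ∧
        (∀ ℓ ∈ n.primeFactors, Zhang2014.IsKolyvaginPrime (W.conductorNorm ℤ) W K 7 ℓ) ∧
        ¬ ∃ Q : (W.baseChange (ringClassField K ι n)).toAffine.Point, (7 : ℤ) • Q = d.derivedPoint

/-- **C⁺ (i) from its datum half: the field is THEOREM A's.** Given the Friedberg–Hoffstein named fact
and Modularity, `KolyvaginDatumHalfSeven → KolyvaginNonvanishingModSevenTypeIII`: take the admissible
`K″` of THEOREM A (`CuspidalDescentHeegnerFieldSupply.lean`, term inlined: tree consumer shape
`exists_heegnerField_split_two_split_oddDiscr_twist_ne_zero` at `7`, bound `B = 4`, so `d_{K″} ≠ −3, −4`), then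
the datum half. [cite: FriedbergHoffstein1995, Thm. B] [cite: Kolyvagin1991, Thm. 1] -/
theorem kolyvaginNonvanishing_of_datumHalf
    (hFH : friedbergHoffstein_exists_heegnerField_splitDivisors_twist_ne_zero)
    (hmod : exists_isNewformOf) (hHalf : KolyvaginDatumHalfSeven) :
    KolyvaginNonvanishingModSevenTypeIII := by
  intro W _ _ _ _ hC hv Dt hc
  -- THEOREM A inline (same term as `HeegnerFieldSupply.ClassCSeven.exists_admissibleHeegnerField`, bound 4;
  -- the certificate module is not imported because Cruxes modules are not farm build targets):
  have hw : W.rootNumber = -1 := by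
    have h := W.rootNumber_eq_neg_one_pow_analyticRank_of_exists_isNewformOf hmod
    rw [hC.2.2.1] at h
    simpa using h
  obtain ⟨K, hF, hN, hK, hB, hHN, hH7, hH2, -, hL⟩ :=
    exists_heegnerField_split_two_split_oddDiscr_twist_ne_zero hFH W hw Nat.prime_seven 4
  have hd8 : NumberField.discr K % 8 = 1 :=
    SatisfiesHeegnerHypothesis.discr_emod_eight hK.1 hH2 (dvd_refl 2)
  have hne3 : NumberField.discr K ≠ -3 := by
    intro h; rw [h] at hB; norm_num at hB
  have hne4 : NumberField.discr K ≠ -4 := by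
    intro h; rw [h] at hB; norm_num at hB
  obtain ⟨β, ι, n, d, hsq, hkoly, hndiv⟩ := hHalf W hC hv Dt hc K hK hHN hH7 hd8 hB hL
  exact ⟨K, hF, hN, hK, hne3, hne4, hHN, β, ι, n, d, hsq, hkoly, hndiv⟩

/-- The same along the Hoffstein–Luo road. [cite: HoffsteinLuo1997, Theorem (§1, pp. 435–436)] -/
theorem kolyvaginNonvanishing_of_datumHalf_of_hoffsteinLuo (hmod : exists_isNewformOf)
    (hHL : HoffsteinLuo1997_exists_twist_L_one_ne_zero) (hHalf : KolyvaginDatumHalfSeven) :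
    KolyvaginNonvanishingModSevenTypeIII :=
  kolyvaginNonvanishing_of_datumHalf
    (friedbergHoffstein_exists_heegnerField_splitDivisors_twist_ne_zero_of_hoffsteinLuo hmod hHL)
    hmod hHalf

end Summit.BirchSwinnertonDyer.BirchSwinnertonDyer.Cruxes.EllipticUnitValueSevenOfGZK.CuspidalDescent

end
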